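import Summits.NavierStokesRegularity.NavierStokesRegularity.Theorems.StrainClockBudgetedCompositions
import Summits.NavierStokesRegularity.NavierStokesRegularity.Theorems.DriftChargedClockDefs
import HarnessLib

/-!
# StrainClockBudgetedClosers — door family S41 «BudgetedClock»: compositions, BOTH DOORS CLOSED BY NAME, zero-budget reductions (§3)

P0-41 part 3 of 3: §3 (`budgetedDriftSmoothing_of`, `budgetedDriftSmoothing_holds` (D6 CLOSED), `budgetedParityDoor_holds` (D5 CLOSED),
`parityRatio_of_budgeted` (D4 = zero budget of D5), `driftCharged_of_budgeted` (D1 = zero budget of D6)) of nsreg-p1 g32's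
`r39/Sketch42.lean` sha16 7255af488b752fb6 (ROUND-39 S41 «BudgetedClock», memo v1.1 2ec8562e2824807f), byte-identical, order
preserved; PLUS (memo §8 option, since P0-40 landed first — the ONLY non-verbatim lines, marked `§3b` below) the two reductions
restated with the S40 door texts BY NAME over p669896 `…Theorems.DriftChargedClockDefs`:
`parityRatioDoor_of_budgetedParityDoor : BudgetedParityDoor → ParityRatioDoor` and
`driftChargedSmoothing_of_budgetedDriftSmoothing : BudgetedDriftSmoothing → DriftChargedSmoothing` (definitional unfolding of
p1's two theorems). Imports part 2 `…Theorems.StrainClockBudgetedCompositions`; cut prepared by ns-s29-p2 g5,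
`--supports stmt-NavierStokesRegularity-0056 --as helper`.  UNCONDITIONAL (no named-fact hypothesis; std axioms per p1's
`r39/axioms42.txt`).

HONEST FRAME: door family S41 «BudgetedClock» = budgeted strain-clock CRITERIA (conditional statements about HYPOTHETICAL blow-up
profiles; the content is the quantitative BKM-shaped residual); items 0056 `NoTypeII`, 10661 and NS regularity are NOT proved;
nothing here is a route or a summit statement.
-/

noncomputable section

open MeasureTheory Set Function Filter Metric Real InnerProductSpace
open _root_.Topology
open scoped ENNReal NNReal RealInnerProductSpace ContDiff Laplacian Interval
open Literature.Analysis Literature.Analysis.FluidPDE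
open Literature.Analysis.FluidPDE.VorticityDirectionDynamics

set_option linter.dupNamespace false

namespace Summit.NavierStokesRegularity.NavierStokesRegularity.Theorems.StrainDoors

open Summit.NavierStokesRegularity.NavierStokesRegularity.Theorems.ArgmaxDoors

-- nested operator types (second derivatives)
set_option maxSynthPendingDepth 3

/-! ## §3 Compositions and closers -/

/-- **Door D6 «BudgetedDriftSmoothing» from the plates**: the budgeted one-slab bound on `[t₀,t]` and
`(L'⁻¹ + κ(t − t₀))⁻¹ ≤ 1/(κ(t − t₀))`. [folklore] -/
theorem budgetedDriftSmoothing_of (hFr : StrainFrameOn) (hW : StrainThresholdWeightedOn) :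
    BudgetedDriftSmoothing := by
  intro ν T t₀ ε ℓ c β Φ b hν ht₀ hT hε hℓ hc hΦ u p hsol hK hhyp t ht x e he
  have h0t : t₀ < t := ht.1
  have htT : t < T := ht.2
  have hsub : Icc t₀ t ⊆ Ico 0 T := fun s hs => ⟨ht₀.trans hs.1, lt_of_le_of_lt hs.2 htT⟩
  have hsol' : IsClassicalNSSolutionOn (Icc t₀ t) ν 0 u p := hsol.mono hsub (uniqueDiffOn_Icc h0t)
  obtain ⟨K, hK'⟩ := hK t htT
  set κ : ℝ := 1 - c with hκ
  have hκ0 : 0 < κ := by rw [hκ]; linarith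
  have h := budgetedSlab_bound hFr hW hν hε hℓ hc h0t hsol' hK'
    (fun s hs => hΦ s ⟨hs.1, lt_of_le_of_lt hs.2 htT⟩)
    (fun s hs y e' hpen hlev => hhyp s ⟨hs.1.le, lt_of_le_of_lt hs.2 htT⟩ y e' hpen hlev) x e he
  have hL'0 : 0 < max K 1 := lt_of_lt_of_le one_pos (le_max_right _ _)
  have hpos : 0 < (1 - c) * (t - t₀) := mul_pos hκ0 (by linarith)
  have hle : ((max K 1)⁻¹ + (1 - c) * (t - t₀))⁻¹ ≤ 1 / ((1 - c) * (t - t₀)) := by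
    rw [one_div]
    apply inv_anti₀ hpos
    have := inv_pos.2 hL'0
    linarith
  have hmono : Real.exp β * (ℓ + 6 * ν * ε / (1 - c) + ((max K 1)⁻¹ + (1 - c) * (t - t₀))⁻¹) ≤
      Real.exp β * (ℓ + 6 * ν * ε / (1 - c) + 1 / ((1 - c) * (t - t₀))) :=
    mul_le_mul_of_nonneg_left (by linarith) (Real.exp_pos β).le
  exact h.trans hmono

/-- **door D6 «BudgetedDriftSmoothing» CLOSED** (no hypothesis). -/
theorem budgetedDriftSmoothing_holds : BudgetedDriftSmoothing :=
  budgetedDriftSmoothing_of strainFrameOn_holds strainThresholdWeighted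

/-- **Door D5 «BudgetedParityDoor» PROVED**: a bound `M` for the strain form at `t₀`; on `[t₀,T)` the EXPONENTIAL
barrier `B(t) = M'·exp Φ(t)`, `M' := max M l₀ + 1`, solves `B' = b·B` exactly, so with `φ := b` it is a supersolution
for the linear device E2_S♭-lin `strainThresholdAlmostLinear_holds` on every `[t₀,t₂]`, `t₂ < T`; growth at the charged
crossing points from E1_S♭ + F_S + BUDGETED PARITY is `∂ₜq ≤ (b + η(ε))q`; hence `Λ ≤ M'e^β` on `[t₀,T)` and door Λ
`subcriticalStrainDoor_holds` extends. [folklore] -/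
theorem budgetedParityDoor_holds : BudgetedParityDoor := by
  intro ν T t₀ l₀ δ β Φ b hν ht₀ ht₀T hl₀ hδ hδ1 hΦ0 hΦ u p hsol hreg hhyp
  have hT : 0 < T := lt_of_le_of_lt ht₀ ht₀T
  -- slab sup of `|u|`
  have hK : ∀ t₂ : ℝ, 0 < t₂ → t₂ < T →
      ∃ K₀ : ℝ, 0 ≤ K₀ ∧ ∀ t ∈ Icc 0 t₂, ∀ x : EuclideanSpace ℝ (Fin 3), ‖u t x‖ ≤ K₀ := by
    intro t₂ ht₂0 ht₂T
    have hS : IsClassicalNSSolutionOn (Icc 0 t₂) ν 0 u p :=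
      hsol.mono (Icc_subset_Ico_right ht₂T) (uniqueDiffOn_Icc ht₂0)
    exact exists_forall_norm_le_of_hasBoundedSobolevNormsOn hS (hreg t₂ ht₂T)
  -- ### Step 1: the strain form at `t₀` is bounded
  obtain ⟨M, hM0, hM⟩ : ∃ M : ℝ, 0 ≤ M ∧
      ∀ (x e : EuclideanSpace ℝ (Fin 3)), ‖e‖ = 1 → strainQuad u t₀ x e ≤ M := by
    set T'' : ℝ := (t₀ + T) / 2 with hT''
    have hT''T : T'' < T := by rw [hT'']; linarith
    have ht₀T'' : t₀ ≤ T'' := by rw [hT'']; linarith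
    have hsm : ∀ r ∈ Icc 0 T'', ContDiff ℝ ∞ (u r) := fun r hr =>
      hsol.contDiff_velocity ⟨hr.1, lt_of_le_of_lt hr.2 hT''T⟩
    obtain ⟨C1, hC1⟩ :=
      exists_forall_norm_iteratedFDeriv_le_of_hasBoundedSobolevNormsOn hsm (hreg T'' hT''T) 1
    refine ⟨max C1 0, le_max_right _ _, fun x e he => ?_⟩
    have h := hC1 t₀ ⟨ht₀, ht₀T''⟩ x
    rw [norm_iteratedFDeriv_one] at h
    exact ((strainQuad_le_opNorm u t₀ x he).trans h).trans (le_max_left _ _)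
  set M' : ℝ := max M l₀ + 1 with hM'
  have hM'M : M < M' := by rw [hM']; linarith [le_max_left M l₀]
  have hM'l : l₀ < M' := by rw [hM']; linarith [le_max_right M l₀]
  have hM'pos : 0 < M' := lt_of_le_of_lt hl₀ hM'l
  -- the exponential barrier and its bound
  set B : ℝ → ℝ := fun s => M' * Real.exp (Φ s) with hB
  have hBpos : ∀ s, 0 < B s := fun s => mul_pos hM'pos (Real.exp_pos _)
  have hBge : ∀ s ∈ Ico t₀ T, M' ≤ B s := fun s hs => by
    have h1 : 1 ≤ Real.exp (Φ s) := Real.one_le_exp (hΦ s hs).1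
    have : M' * 1 ≤ M' * Real.exp (Φ s) := mul_le_mul_of_nonneg_left h1 hM'pos.le
    simpa [hB] using this
  have hBle : ∀ s ∈ Ico t₀ T, B s ≤ M' * Real.exp β := fun s hs =>
    mul_le_mul_of_nonneg_left (Real.exp_le_exp.2 (hΦ s hs).2.1) hM'pos.le
  -- ### Step 2: `⟪∇u e,e⟫ ≤ B(t) ≤ M' e^β` on `[t₀,T)` (exponential barrier, `φ := b`, through the linear device)
  have hbound : ∀ t ∈ Ico t₀ T, ∀ (x e : EuclideanSpace ℝ (Fin 3)), ‖e‖ = 1 →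
      strainQuad u t x e ≤ M' * Real.exp β := by
    intro t ht x e he
    set t₂ : ℝ := (t + T) / 2 with ht₂
    have ht₀t₂ : t₀ < t₂ := by rw [ht₂]; linarith [ht.1, ht.2]
    have ht₂T : t₂ < T := by rw [ht₂]; linarith [ht.2]
    have htt₂ : t ≤ t₂ := by rw [ht₂]; linarith [ht.2]
    have hsub : ∀ s ∈ Icc t₀ t₂, s ∈ Ico t₀ T := fun s hs => ⟨hs.1, lt_of_le_of_lt hs.2 ht₂T⟩
    obtain ⟨K₀, -, hK₀⟩ := hK t₂ (lt_of_le_of_lt ht₀ ht₀t₂) ht₂T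
    have hrate : ∀ ε : ℝ, 0 < ε → ε ≤ 1 → ∀ s ∈ Ioc t₀ t₂, ∀ (x e : EuclideanSpace ℝ (Fin 3)), ‖e‖ = 1 →
        (∀ (y e' : EuclideanSpace ℝ (Fin 3)), ‖e'‖ = 1 →
          (1 + ε * ‖y‖ ^ 2)⁻¹ * strainQuad u s y e' ≤ (1 + ε * ‖x‖ ^ 2)⁻¹ * strainQuad u s x e) →
        (∀ (y e' : EuclideanSpace ℝ (Fin 3)), ‖e'‖ = 1 → (1 - δ) * strainQuad u s y e' ≤ strainQuad u s x e) →
        B s < strainQuad u s x e →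
        strainRate T u s x e ≤ (b s + (6 * ν * ε + Real.sqrt ε * K₀)) * strainQuad u s x e := by
      intro ε hε _ s hs x e he hpen halm hbig
      have hsI : s ∈ Ico 0 T := ⟨ht₀.trans hs.1.le, lt_of_le_of_lt hs.2 ht₂T⟩
      have hsI' : s ∈ Ico t₀ T := ⟨hs.1.le, hsI.2⟩
      have hbig' : M' < strainQuad u s x e := lt_of_le_of_lt (hBge s hsI') hbig
      have hq0 : 0 < strainQuad u s x e := hM'pos.trans hbig'
      have hsm : ContDiff ℝ ∞ (u s) := hsol.smooth_velocity.contDiff_slice hsI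
      have heq := strainFrame_holds ν T hν hT u p hsol s hsI x e
      have hE := strainGrowthWeighted ν ε hν.le hε (u s) (p s) hsm x e he (fun y => hpen y e he) hq0.le _ heq
      have hfeed := hhyp s hsI' x e ⟨he, halm⟩ (hM'l.trans hbig')
      have hux : ‖u s x‖ ≤ K₀ := hK₀ s ⟨hsI.1, hs.2⟩ x
      have h1 : strainRate T u s x e ≤ -(strainQuad u s x e) ^ 2 + strainFeed u p s x e +
          (6 * ν * ε + Real.sqrt ε * ‖u s x‖) * strainQuad u s x e := by
        unfold strainRate strainQuad strainFeed pressureHess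
        linarith [hE]
      have hallow : (6 * ν * ε + Real.sqrt ε * ‖u s x‖) * strainQuad u s x e ≤
          (6 * ν * ε + Real.sqrt ε * K₀) * strainQuad u s x e := by
        apply mul_le_mul_of_nonneg_right _ hq0.le
        have := mul_le_mul_of_nonneg_left hux (Real.sqrt_nonneg ε)
        linarith
      rw [add_mul]
      linarith [h1, hallow, hfeed]
    have hBc : ContinuousOn B (Icc t₀ t₂) := fun s hs =>
      (continuousAt_const.mul ((hΦ s (hsub s hs)).2.2.continuousAt.rexp)).continuousWithinAt
    have hBd : ∀ s ∈ Icc t₀ t₂, HasDerivWithinAt B (M' * (Real.exp (Φ s) * b s)) (Icc t₀ t₂) s := fun s hs =>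
      (((hΦ s (hsub s hs)).2.2).exp.const_mul M').hasDerivWithinAt
    have hq := strainThresholdAlmostLinear_holds ν T t₀ t₂ δ (fun ε => 6 * ν * ε + Real.sqrt ε * K₀) hν ht₀
      ht₀t₂ ht₂T hδ hδ1 (tendsto_allowance ν K₀) u p hsol hreg B (fun s => M' * (Real.exp (Φ s) * b s)) b
      hBc (fun s _ => hBpos s) hBd
      (fun s _ => le_of_eq (by simp only [hB]; ring)) hrate
      (fun x e he => by
        have h0 : B t₀ = M' := by simp only [hB, hΦ0, Real.exp_zero, mul_one]
        rw [h0]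
        exact (hM x e he).trans hM'M.le)
      t ⟨ht.1, htt₂⟩ x e he
    exact hq.trans (hBle t ht)
  -- ### Step 3: door Λ with `y₀ = 1/2` on `[t₁, T)`
  set M'' : ℝ := M' * Real.exp β with hM''
  have hM''pos : 0 < M'' := mul_pos hM'pos (Real.exp_pos β)
  set t₁ : ℝ := max t₀ (T - 1 / (2 * M'')) with ht₁
  have ht₁0 : 0 ≤ t₁ := ht₀.trans (le_max_left _ _)
  have ht₁T : t₁ < T := by
    rw [ht₁]
    refine max_lt ht₀T ?_
    have := div_pos one_pos (mul_pos two_pos hM''pos)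
    linarith
  refine subcriticalStrainDoor_holds ν T t₁ (1 / 2) hν ht₁0 ht₁T (by norm_num) u p hsol hreg ?_
  intro t ht x e he
  have hq := hbound t ⟨(le_max_left _ _).trans ht.1, ht.2⟩ x e he
  have hTt : T - t ≤ 1 / (2 * M'') := by
    have := (le_max_right t₀ (T - 1 / (2 * M''))).trans ht.1
    linarith
  have hTt0 : 0 < T - t := sub_pos.2 ht.2
  calc (T - t) * strainQuad u t x e ≤ (T - t) * M'' := mul_le_mul_of_nonneg_left hq hTt0.le
    _ ≤ 1 / (2 * M'') * M'' := mul_le_mul_of_nonneg_right hTt hM''pos.le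
    _ = 1 / 2 := by field_simp


/-- D4 «ParityRatioDoor» (ROUND-38) is the zero-budget case of D5: `Φ ≡ 0`, `b ≡ 0`. -/
theorem parityRatio_of_budgeted (h : BudgetedParityDoor) :
    ∀ (ν T t₀ l₀ δ : ℝ), 0 < ν → 0 ≤ t₀ → t₀ < T → 0 ≤ l₀ → 0 < δ → δ < 1 →
    ∀ (u : ℝ → (EuclideanSpace ℝ (Fin 3)) → (EuclideanSpace ℝ (Fin 3)))
      (p : ℝ → (EuclideanSpace ℝ (Fin 3)) → ℝ),
      IsClassicalNSSolutionOn (Ico 0 T) ν 0 u p →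
      (∀ T'' < T, HasBoundedSobolevNormsOn (Icc 0 T'') u) →
      (∀ t ∈ Ico t₀ T, ∀ (x e : EuclideanSpace ℝ (Fin 3)), IsStrainAlmostArgmax δ u t x e →
        l₀ < strainQuad u t x e → strainFeed u p t x e ≤ strainQuad u t x e ^ 2) →
      HasSobolevExtensionPast ν u T := by
  intro ν T t₀ l₀ δ hν ht₀ ht₀T hl₀ hδ hδ1 u p hsol hreg hhyp
  refine h ν T t₀ l₀ δ 0 (fun _ => 0) (fun _ => 0) hν ht₀ ht₀T hl₀ hδ hδ1 rfl
    (fun t _ => ⟨le_rfl, le_rfl, hasDerivAt_const t 0⟩) u p hsol hreg fun t ht x e halm hlev => ?_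
  have := hhyp t ht x e halm hlev
  simpa using this

/-- D1 «DriftChargedSmoothing» (ROUND-38) is the zero-budget case of D6: `Φ ≡ 0`, `b ≡ 0`, `e^0 = 1`. -/
theorem driftCharged_of_budgeted (h : BudgetedDriftSmoothing) :
    ∀ (ν T t₀ ε ℓ c : ℝ), 0 < ν → 0 ≤ t₀ → t₀ < T → 0 < ε → 0 ≤ ℓ → c < 1 →
    ∀ (u : ℝ → (EuclideanSpace ℝ (Fin 3)) → (EuclideanSpace ℝ (Fin 3)))
      (p : ℝ → (EuclideanSpace ℝ (Fin 3)) → ℝ),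
      IsClassicalNSSolutionOn (Ico 0 T) ν 0 u p →
      (∀ T' : ℝ, T' < T → ∃ K : ℝ, ∀ t ∈ Icc t₀ T', ∀ x : EuclideanSpace ℝ (Fin 3), ‖fderiv ℝ (u t) x‖ ≤ K) →
      (∀ t ∈ Ico t₀ T, ∀ (x e : EuclideanSpace ℝ (Fin 3)), IsStrainPenalisedArgmax ε u t x e →
        ℓ < (1 + ε * ‖x‖ ^ 2)⁻¹ * strainQuad u t x e →
        strainFeed u p t x e + Real.sqrt ε * ‖u t x‖ * strainQuad u t x e ≤ c * strainQuad u t x e ^ 2) →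
      ∀ t ∈ Ioo t₀ T, ∀ (x e : EuclideanSpace ℝ (Fin 3)), ‖e‖ = 1 →
        (1 + ε * ‖x‖ ^ 2)⁻¹ * strainQuad u t x e ≤ ℓ + 6 * ν * ε / (1 - c) + 1 / ((1 - c) * (t - t₀)) := by
  intro ν T t₀ ε ℓ c hν ht₀ hT hε hℓ hc u p hsol hK hhyp t ht x e he
  have h' := h ν T t₀ ε ℓ c 0 (fun _ => 0) (fun _ => 0) hν ht₀ hT hε hℓ hc
    (fun s _ => ⟨le_rfl, le_rfl, hasDerivAt_const s 0⟩) u p hsol hK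
    (fun s hs y e' hpen hlev => by
      have := hhyp s hs y e' hpen hlev
      simpa using this) t ht x e he
  simpa using h'


/-! ## §3b By-name form of the zero-budget reductions (ns-s29-p2 g5; memo §8 option — the S40 texts are in the tree, p669896) -/

/-- D4 «ParityRatioDoor» (S40, by name) from D5 «BudgetedParityDoor»: `parityRatio_of_budgeted` with the conclusion folded. -/
theorem parityRatioDoor_of_budgetedParityDoor (h : BudgetedParityDoor) : ParityRatioDoor :=
  parityRatio_of_budgeted h

/-- D1 «DriftChargedSmoothing» (S40, by name) from D6 «BudgetedDriftSmoothing»: `driftCharged_of_budgeted` with the conclusion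
folded. -/
theorem driftChargedSmoothing_of_budgetedDriftSmoothing (h : BudgetedDriftSmoothing) : DriftChargedSmoothing :=
  driftCharged_of_budgeted h

end Summit.NavierStokesRegularity.NavierStokesRegularity.Theorems.StrainDoors

end
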